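import Summits.SmoothPoincare4.SmoothPoincare4.Theses.SymplecticOrigami
import Summits.SmoothPoincare4.SmoothPoincare4.Theses.Stabilisation
import Literature.Geometry.Symplectic.SphereProdSymplecticHost
import Literature.Geometry.Manifold.OpenSubmanifoldMFDeriv
import Literature.Topology.FourManifolds.HomotopySpheres
import Literature.Topology.FourManifolds.HomotopySpheresProofs
import Literature.Topology.FourManifolds.ConnectedSum
import Literature.Topology.FourManifolds.UnorientedDiscTheorem
import Literature.Topology.FourManifolds.EquidimensionalEmbedding
import Mathlib.Analysis.InnerProductSpace.Projection.FiniteDimensional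

/-!
# Line `stable-seam-host` (crux `OrigamiFoldExistence`, stmt-SmoothPoincare4-7844): the glue `StabOneSuffices ⇒ STUB 1`

Worker A certificate (wave 1 of lead c9).  The registered STUB 1 `stub_hostEmbedding` ("the fake
ball `Δ_e = S ∖ e(B̊⁴)` of every homotopy 4-sphere embeds in a closed simply connected symplectic
`ℝ⁴`-charted host with a square-zero symplectic sphere pair") FOLLOWS from one-stabilisation,
the crux `Summit.SmoothPoincare4.SmoothPoincare4.Theses.Stabilisation.StabOneSuffices`
(stmt-SmoothPoincare4-0386: `Σ # S² × S² ≅ S² × S²`), kernel-checked: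

* `helper_hostEmbedding_of_stabOne` — pointwise: if `P ⊇` the punctured `S` is a connected sum
  `S # S² × S²` (`Literature.Topology.FourManifolds.IsConnectedSum`) with a diffeomorphism
  `Φ : P ≃ₘ S² × S²`, then STUB 1 holds for `S` and EVERY chart ball `e`, with host `X = P`,
  `Ω = Φ^*(σ ⊕ σ)`, `c, c' = Φ⁻¹ ∘ (·, ±q₀)` (tree: `sphereProd_hostPackage_of_diffeomorph`,
  bricks `SphereAreaForm` / `SphereProdSymplecticForm` / `SphereProdSymplecticHost`), and
  `J = j_A ∘ f` where `j_A : S ∖ {i₁ 0} ↪ P` is the gluing map of the sum and `f : S ≅ S` is the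
  diffeomorphism of the UNORIENTED DISC THEOREM (Palais 1960 / Hirsch 8.3.1, tree theorem
  `exists_diffeomorph_apply_disc_eq_or_reflect_of_model`) carrying the chart disc `e(B⁴)` onto
  the sum disc `i₁(B⁴)` (possibly after a reflection, which preserves `B̊⁴`), so that
  `f(Δ_e) = S ∖ i₁(B̊⁴)` lies in the punctured summand; `J` is `C^∞`, injective and has bijective
  differential (`j_A` is an open smooth embedding in equal dimension: a local diffeomorphism,
  `Manifold.IsSmoothEmbedding.isLocalDiffeomorph_of_finrank_eq`) on the open set
  `U = f⁻¹(S ∖ i₁(½B⁴)) ⊇ Δ_e`.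
* `helper_hostEmbedding_of_stabOneSuffices` — hence `StabOneSuffices →` STUB 1 (signature of
  `stub_hostEmbedding` verbatim): the line's STUB 1 is formally WEAKER than crux stmt-0386.

No definitions, no named facts, no `sorry`.
-/

noncomputable section

-- the prescribed namespace `Summit.<P>.<Sub>.…` duplicates `SmoothPoincare4` (P = Sub)
set_option linter.dupNamespace false

open scoped Manifold ContDiff Topology
open Set Function

namespace Summit.SmoothPoincare4.SmoothPoincare4.Theorems.OrigamiFoldExistence.StableSeamHost

open Literature.Geometry.Symplectic Literature.Topology.FourManifolds

/-- A point of the round 2-sphere and its antipode are distinct: `q₀ ≠ -q₀`. [folklore] -/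
private theorem pole_ne_neg :
    (⟨EuclideanSpace.single 0 1, by simp⟩ : Metric.sphere (0 : EuclideanSpace ℝ (Fin 3)) 1) ≠
      -⟨EuclideanSpace.single 0 1, by simp⟩ :=
  ne_neg_of_mem_unit_sphere ℝ _

/-- A linear automorphism of `ℝ⁴` with negative determinant preserving the norm: the orthogonal
reflection in a coordinate hyperplane (Mathlib's `Submodule.reflection`, `det = (-1)¹`).
[folklore] -/
private theorem exists_reflection_four :
    ∃ r : EuclideanSpace ℝ (Fin 4) ≃L[ℝ] EuclideanSpace ℝ (Fin 4),
      LinearMap.det (r.toLinearEquiv : EuclideanSpace ℝ (Fin 4) →ₗ[ℝ] EuclideanSpace ℝ (Fin 4)) < 0 ∧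
        ∀ y, ‖r y‖ = ‖y‖ := by
  set v : EuclideanSpace ℝ (Fin 4) := EuclideanSpace.single 0 1 with hv
  have hv0 : v ≠ 0 := fun h => by
    have := congrArg (fun w : EuclideanSpace ℝ (Fin 4) => w 0) h
    simp [hv] at this
  set K : Submodule ℝ (EuclideanSpace ℝ (Fin 4)) := (ℝ ∙ v)ᗮ with hK
  refine ⟨K.reflection.toContinuousLinearEquiv, ?_, fun y => K.reflection.norm_map y⟩
  have h1 : LinearMap.det ((K.reflection.toContinuousLinearEquiv).toLinearEquiv :
      EuclideanSpace ℝ (Fin 4) →ₗ[ℝ] EuclideanSpace ℝ (Fin 4)) =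
        LinearMap.det K.reflection.toLinearMap := rfl
  rw [h1, Submodule.det_reflection, hK, Submodule.orthogonal_orthogonal, finrank_span_singleton hv0]
  norm_num

/-- **`StabOneSuffices` at `S` gives STUB 1 at `S`**: if the punctured homotopy 4-sphere `S` and
the punctured `S² × S²` glue to an `ℝ⁴`-charted `P` (`IsConnectedSum`) diffeomorphic to
`S² × S²`, then for every chart ball `e` a neighbourhood of the fake ball `S ∖ e(B̊⁴)` embeds
into the closed simply connected symplectic host `(P, Φ^*(σ ⊕ σ))`, which carries the square-zero
symplectic sphere `Φ⁻¹(S² × {q₀})` and its disjoint homotopic push-off `Φ⁻¹(S² × {-q₀})` (unoriented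
disc theorem to move `e(B⁴)` onto the sum disc; the gluing map is an equidimensional open smooth
embedding; Palais 1960 Thm. B / Hirsch 8.3.1 through the tree theorem). [folklore] -/
theorem helper_hostEmbedding_of_stabOne :
    ∀ (S : Literature.Topology.FourManifolds.HomotopySphere 4) (e : EuclideanSpace ℝ (Fin 4) → S.carrier), Manifold.IsSmoothEmbedding (𝓡 4) (𝓡 4) ∞ e → (∃ (P : Type) (_ : TopologicalSpace P) (_ : ChartedSpace (EuclideanSpace ℝ (Fin 4)) P) (_ : IsManifold (𝓡 4) ∞ P), Literature.Topology.FourManifolds.IsConnectedSum (𝓡 4) (𝓡 4) ((𝓡 2).prod (𝓡 2)) S.carrier ((Metric.sphere (0 : EuclideanSpace ℝ (Fin 3)) 1) × (Metric.sphere (0 : EuclideanSpace ℝ (Fin 3)) 1)) P ∧ Nonempty (P ≃ₘ⟮𝓡 4, (𝓡 2).prod (𝓡 2)⟯ ((Metric.sphere (0 : EuclideanSpace ℝ (Fin 3)) 1) × (Metric.sphere (0 : EuclideanSpace ℝ (Fin 3)) 1)))) → ∃ (X : Type) (_ : TopologicalSpace X) (_ : T2Space X) (_ : SecondCountableTopology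 X) (_ : CompactSpace X) (_ : ChartedSpace (EuclideanSpace ℝ (Fin 4)) X) (_ : IsManifold (𝓡 4) ∞ X) (_ : SimplyConnectedSpace X) (Ω : Literature.Geometry.Kaehler.MForm (𝓡 4) X ℝ 2) (J : S.carrier → X) (c c' : (Metric.sphere (0 : EuclideanSpace ℝ (Fin 3)) 1) → X), (Literature.Geometry.Kaehler.IsSmoothForm Ω ∧ Literature.Geometry.Kaehler.IsClosedForm Ω ∧ ∀ x (v : TangentSpace (𝓡 4) x), v ≠ 0 → ∃ w, Ω x ![v, w] ≠ 0) ∧ (∃ U : Set S.carrier, IsOpen U ∧ (e '' Metric.ball (0 : EuclideanSpace ℝ (Fin 4)) 1)ᶜ ⊆ U ∧ ContMDiffOn (𝓡 4) (𝓡 4) ∞ J U ∧ Set.InjOn J U ∧ ∀ x ∈ U, Function.Bijective (mfderiv (𝓡 4) (𝓡 4) J x)) ∧ (Manifold.IsSmoothEmbedding (𝓡 2) (𝓡 4) ∞ c ∧ (∀ y (v : TangentSpace (𝓡 2) y), v ≠ 0 → ∃ w : TangentSpace (𝓡 2) y, Ω (c y) ![mfderiv (𝓡 2) (𝓡 4)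 c y v, mfderiv (𝓡 2) (𝓡 4) c y w] ≠ 0) ∧ Manifold.IsSmoothEmbedding (𝓡 2) (𝓡 4) ∞ c' ∧ Disjoint (Set.range c) (Set.range c') ∧ ∃ H : unitInterval × (Metric.sphere (0 : EuclideanSpace ℝ (Fin 3)) 1) → X, Continuous H ∧ ∀ y, H (0, y) = c y ∧ H (1, y) = c' y) := by
  intro S e he hStab
  obtain ⟨P, _, _, _, hCS, ⟨Φ⟩⟩ := hStab
  haveI : Fact (Module.finrank ℝ (EuclideanSpace ℝ (Fin 3)) = 2 + 1) := ⟨finrank_euclideanSpace_fin⟩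
  -- point-set instances on `P`, transported from `S² × S²` along `Φ`
  let eP : P ≃ₜ ((Metric.sphere (0 : EuclideanSpace ℝ (Fin 3)) 1) ×
      (Metric.sphere (0 : EuclideanSpace ℝ (Fin 3)) 1)) := Φ.toHomeomorph
  haveI : T2Space P := eP.symm.t2Space
  haveI : SecondCountableTopology P := eP.secondCountableTopology
  haveI : CompactSpace P := eP.symm.compactSpace
  haveI : SimplyConnectedSpace ((Metric.sphere (0 : EuclideanSpace ℝ (Fin 3)) 1) ×
      (Metric.sphere (0 : EuclideanSpace ℝ (Fin 3)) 1)) :=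
    Literature.Topology.FourManifolds.SphereProd.simplyConnectedSpace (k := 2) le_rfl
  haveI : SimplyConnectedSpace P := eP.toHomotopyEquiv.simplyConnectedSpace
  -- the host data on `P`
  have hP := sphereProd_hostPackage_of_diffeomorph Φ pole_ne_neg
  -- the connected-sum data: discs `i₁ : ℝ⁴ ↪ S`, `i₂`, and the gluing map `jA` of `S ∖ {i₁ 0}`
  obtain ⟨i₁, i₂, hi₁, -, jA, jB, hjA, hjAo, -, -, -, -⟩ := hCS
  -- `jA` is a local diffeomorphism (equidimensional open smooth embedding)
  have hloc : IsLocalDiffeomorph (𝓡 4) (𝓡 4) ∞ jA :=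
    hjA.isLocalDiffeomorph_of_finrank_eq rfl
  -- the total extension `J₀ : S → P` of `jA`
  obtain ⟨u, hu⟩ : ∃ u : EuclideanSpace ℝ (Fin 4), u ≠ 0 := exists_ne 0
  have hu1 : i₁ u ∈ (puncture i₁ : Set S.carrier) := fun h => hu (hi₁.isEmbedding.injective h)
  set J₀ : S.carrier → P := Subtype.val.extend jA (fun _ => jA ⟨i₁ u, hu1⟩) with hJ₀
  have hJ₀val : ∀ x : ↥(puncture i₁), J₀ x = jA x := fun x =>
    Subtype.val_injective.extend_apply _ _ x
  have hJ₀fun : (fun x : ↥(puncture i₁) => J₀ x) = jA := funext hJ₀val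
  have hJ₀s : ContMDiffOn (𝓡 4) (𝓡 4) ∞ J₀ (puncture i₁ : Set S.carrier) := fun x hx =>
    (contMDiffAt_subtype_iff.1 (by rw [hJ₀fun]; exact hjA.contMDiff ⟨x, hx⟩)).contMDiffWithinAt
  have hJ₀i : InjOn J₀ (puncture i₁ : Set S.carrier) := fun x hx y hy hxy => by
    have h := hjA.isEmbedding.injective (a₁ := ⟨x, hx⟩) (a₂ := ⟨y, hy⟩)
      (by rw [← hJ₀val, ← hJ₀val]; exact hxy)
    exact congrArg Subtype.val h
  have hJ₀d : ∀ x (hx : x ∈ (puncture i₁ : Set S.carrier)),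
      Bijective (mfderiv (𝓡 4) (𝓡 4) J₀ x) := by
    intro x hx
    have hxd : MDifferentiableAt (𝓡 4) (𝓡 4) J₀ x :=
      ((hJ₀s x hx).contMDiffAt ((puncture i₁).isOpen.mem_nhds hx)).mdifferentiableAt (by simp)
    have hvd : MDifferentiableAt (𝓡 4) (𝓡 4) (Subtype.val : ↥(puncture i₁) → S.carrier) ⟨x, hx⟩ :=
      (contMDiff_subtype_val (n := ∞)).mdifferentiableAt (by simp)
    have e1 := mfderiv_comp (⟨x, hx⟩ : ↥(puncture i₁)) hxd hvd
    have hcomp : J₀ ∘ (Subtype.val : ↥(puncture i₁) → S.carrier) = jA := hJ₀fun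
    rw [hcomp, Literature.Geometry.Manifold.OpenSubmanifold.mfderiv_subtype_val] at e1
    have hb := ((hloc ⟨x, hx⟩).mfderivToContinuousLinearEquiv (by simp)).bijective
    have hfun : ⇑(mfderiv (𝓡 4) (𝓡 4) jA ⟨x, hx⟩) = ⇑(mfderiv (𝓡 4) (𝓡 4) J₀ x) := by
      funext v
      rw [e1]
      rfl
    exact hfun ▸ hb
  -- unoriented disc theorem: move the chart disc onto the sum disc
  haveI : ConnectedSpace S.carrier := HomotopySphere.connectedSpace (by norm_num) S
  obtain ⟨r, hr, hrn⟩ := exists_reflection_four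
  obtain ⟨f, hf⟩ := exists_diffeomorph_apply_disc_eq_or_reflect_of_model (I := 𝓡 4)
    (by simp) he hi₁ r hr
  have hfe : ∀ x, x ∉ e '' Metric.ball (0 : EuclideanSpace ℝ (Fin 4)) 1 →
      f x ∉ i₁ '' Metric.ball (0 : EuclideanSpace ℝ (Fin 4)) 1 := by
    rintro x hx ⟨z, hz, hzx⟩
    have hz1 : ‖z‖ ≤ 1 := (mem_ball_zero_iff.1 hz).le
    rcases hf with hf | hf
    · have h1 : f (e z) = f x := (hf z hz1).trans hzx
      exact hx ⟨z, hz, EquivLike.injective f h1⟩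
    · have h1 : f (e (r z)) = f x := (hf z hz1).trans hzx
      refine hx ⟨r z, ?_, EquivLike.injective f h1⟩
      rw [mem_ball_zero_iff, hrn]
      exact mem_ball_zero_iff.1 hz
  -- the open set `U = f⁻¹(S ∖ i₁(½B⁴))`
  set D : Set S.carrier := i₁ '' Metric.closedBall (0 : EuclideanSpace ℝ (Fin 4)) 2⁻¹ with hD
  have hDc : IsClosed D :=
    ((isCompact_closedBall _ _).image hi₁.contMDiff.continuous).isClosed
  have hDp : Dᶜ ⊆ (puncture i₁ : Set S.carrier) := fun x hx h0 =>
    hx ⟨0, Metric.mem_closedBall_self (by norm_num), h0.symm⟩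
  have hfd : MDifferentiable (𝓡 4) (𝓡 4) f := f.mdifferentiable (by simp)
  refine ⟨P, inferInstance, inferInstance, inferInstance, inferInstance, inferInstance,
    inferInstance, inferInstance, hostFormOfDiffeo Φ, J₀ ∘ f, hostSliceOfDiffeo Φ _,
    hostSliceOfDiffeo Φ _, hP.1, ⟨f ⁻¹' Dᶜ, hDc.isOpen_compl.preimage f.continuous, ?_, ?_, ?_, ?_⟩,
    hP.2⟩
  · -- the fake ball lies in `U`
    intro x hx hxD
    obtain ⟨z, hz, hzx⟩ := hxD
    exact hfe x hx ⟨z, Metric.closedBall_subset_ball (by norm_num) hz, hzx⟩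
  · -- smoothness
    exact hJ₀s.comp f.contMDiff.contMDiffOn fun x hx => hDp hx
  · -- injectivity
    intro x hx y hy hxy
    exact EquivLike.injective f (hJ₀i (hDp hx) (hDp hy) hxy)
  · -- bijective differential
    intro x hx
    have hx' : f x ∈ (puncture i₁ : Set S.carrier) := hDp hx
    rw [mfderiv_comp x (((hJ₀s _ hx').contMDiffAt ((puncture i₁).isOpen.mem_nhds hx')).mdifferentiableAt
      (by simp)) (hfd x)]
    exact (hJ₀d _ hx').comp (bijective_mfderiv_diffeomorph f x)

/-- **The glue `StabOneSuffices ⇒ stub_hostEmbedding`** (conclusion = the registered signature of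
STUB 1 verbatim): one-stabilisation of every homotopy 4-sphere (crux stmt-SmoothPoincare4-0386 of
route Stabilisation) implies the rational-host stub of line `stable-seam-host`, with host
`Σ # S² × S² ≅ S² × S²` itself. [folklore] -/
theorem helper_hostEmbedding_of_stabOneSuffices :
    Summit.SmoothPoincare4.SmoothPoincare4.Theses.Stabilisation.StabOneSuffices → ∀ (S : Literature.Topology.FourManifolds.HomotopySphere 4) (e : EuclideanSpace ℝ (Fin 4) → S.carrier), Manifold.IsSmoothEmbedding (𝓡 4) (𝓡 4) ∞ e → ∃ (X : Type) (_ : TopologicalSpace X) (_ : T2Space X) (_ : SecondCountableTopology X) (_ : CompactSpace X) (_ : ChartedSpace (EuclideanSpace ℝ (Fin 4)) X) (_ : IsManifold (𝓡 4) ∞ X) (_ : SimplyConnectedSpace X) (Ω : Literature.Geometry.Kaehler.MForm (𝓡 4) X ℝ 2) (J : S.carrier → X) (c c' : (Metric.sphere (0 : EuclideanSpace ℝ (Fin 3)) 1) → X), (Literature.Geometry.Kaehler.IsSmoothForm Ω ∧ Literature.Geometry.Kaehler.IsClosedForm Ω ∧ ∀ x (v : TangentSpace (𝓡 4) x), v ≠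 0 → ∃ w, Ω x ![v, w] ≠ 0) ∧ (∃ U : Set S.carrier, IsOpen U ∧ (e '' Metric.ball (0 : EuclideanSpace ℝ (Fin 4)) 1)ᶜ ⊆ U ∧ ContMDiffOn (𝓡 4) (𝓡 4) ∞ J U ∧ Set.InjOn J U ∧ ∀ x ∈ U, Function.Bijective (mfderiv (𝓡 4) (𝓡 4) J x)) ∧ (Manifold.IsSmoothEmbedding (𝓡 2) (𝓡 4) ∞ c ∧ (∀ y (v : TangentSpace (𝓡 2) y), v ≠ 0 → ∃ w : TangentSpace (𝓡 2) y, Ω (c y) ![mfderiv (𝓡 2) (𝓡 4) c y v, mfderiv (𝓡 2) (𝓡 4) c y w] ≠ 0) ∧ Manifold.IsSmoothEmbedding (𝓡 2) (𝓡 4) ∞ c' ∧ Disjoint (Set.range c) (Set.range c') ∧ ∃ H : unitInterval × (Metric.sphere (0 : EuclideanSpace ℝ (Fin 3)) 1) → X, Continuous H ∧ ∀ y, H (0, y) = c y ∧ H (1, y) = c' y) :=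
  fun h S e he => helper_hostEmbedding_of_stabOne S e he (h S)

end Summit.SmoothPoincare4.SmoothPoincare4.Theorems.OrigamiFoldExistence.StableSeamHost

end
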